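import Literature.NumberTheory.Sieve.BombieriFriedlanderIwaniecCaseTools
import Literature.NumberTheory.Sieve.BombieriFriedlanderIwaniecRoughBox
import HarnessLib

/-!
# Bombieri–Friedlander–Iwaniec 1986, §17: Case B — one large smooth variable

Topic `Literature/NumberTheory/Sieve`, companion to
`Literature.NumberTheory.Sieve.BombieriFriedlanderIwaniecCaseTools` and `…RoughBox`.  Everything
here is PROVED (from the named facts
`Literature.NumberTheory.Sieve.BombieriFriedlanderIwaniecTheorem5StarInterval`, BFI Theorem 5* as
applied in §15, and `Literature.NumberTheory.Sieve.SieveSequence.fundamental_lemma_uniform`).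
BFI §17, p. 249: "Suppose there is no partial sum of (15.6) in (17.3) … Hence `ν₁ ≥ 3/7` and
Theorem 5* is applicable with `M = N₁ = x^{ν₁} ≥ x^{3/7}` and `Q, R ≤ x^{2/7−2ε}`."  Here the large
variable carries the coefficient `1_{(P,P']} · 1_{(·,P(z))=1}` (a boxed, sieved factor `1`):

* `Literature.NumberTheory.Sieve.BFI.caseB1_bound` — `X'^{3/7−ε} < M ≤ X'^{1−ε/100}`: Theorem 5*,
  the well-factorable weight split at `D₂ = X'^{1/7+ε/50}` (`thm5_ranges'`);
* `Literature.NumberTheory.Sieve.BFI.caseB2_bound` — `M > X'^{1−ε/100}` (where (A₁) fails): the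
  fundamental lemma per modulus (`sum_abs_bilinDisc_roughBox_le`, sieve level `x^{1/7}`,
  `z = exp(√log x)`), the cofactor being either divisor-bounded on `n ∼ N` or the unit `δ₁`.

Both give `|∑_{d ≤ x^{4/7−ε}, (d,a)=1} λ(d) Δ_{α⋆β}(d)| ≤ C x (log x)^{−A₅}` for `x ≥ x₀`.

## References

* E. Bombieri, J. B. Friedlander, H. Iwaniec, *Primes in arithmetic progressions to large moduli*,
  Acta Math. 156 (1986), 203–251, §2 Lemma 4 p. 211, §12 Theorem 5* p. 238, §17 p. 249.
  [BombieriFriedlanderIwaniecActa1986]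
-/

open Finset Real
open scoped ArithmeticFunction.sigma

namespace Literature.NumberTheory.Sieve

namespace BFI

/-! ### Case B1: Theorem 5* -/

/-- The large-`x` facts used by Case B (one existential witness). [folklore] -/
theorem eventually_caseB (x₅ : ℝ) :
    ∃ x₀ : ℝ, ∀ x : ℝ, x₀ ≤ x → x₅ ≤ x ∧ Real.exp (Real.exp 1) ≤ x ∧ (2 : ℝ) ^ 15 ≤ x := by
  refine ⟨max x₅ (max (Real.exp (Real.exp 1)) (2 ^ 15)), fun x hx => ⟨?_, ?_, ?_⟩⟩
  · exact le_trans (le_max_left _ _) hx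
  · exact le_trans ((le_max_left _ _).trans (le_max_right _ _)) hx
  · exact le_trans ((le_max_right _ _).trans (le_max_right _ _)) hx

/-- **Case B1 of §17: one large smooth variable, Theorem 5*.**  Let `λ` be well factorable of level
`D = x^{4/7−ε}` (`0 < ε ≤ 1/1000`), `x ≤ X' ≤ 2^{15} x`, `MN = X'` with
`X'^{3/7−ε} < M ≤ X'^{1−ε/100}`, `α = 1_{(P,P']} · 1_{(·,P(z))=1}` on `m ∼ M` with
`z ≤ exp(√log x)`, and `|β| ≤ τ^{13}`.  Then, from
`Literature.NumberTheory.Sieve.BombieriFriedlanderIwaniecTheorem5StarInterval` (blocks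
`Q ≤ D₁/2`, `R ≤ D₂/2`, `D₂ = X'^{1/7+ε/50}`, ranges by `thm5_ranges'`):
`|∑_{d ≤ D, (d,a)=1} λ(d) Δ_{α⋆β}(d)| ≤ C x (log x)^{−A₅}` for `x ≥ x₀ = x₀(a, ε, A₅)`.
(BFI §17, p. 249: "Hence `ν₁ ≥ 3/7` and Theorem 5* is applicable with `M = N₁ = x^{ν₁}`".)
[cite: BombieriFriedlanderIwaniecActa1986, §17 p. 249] -/
theorem caseB1_bound (h5 : BombieriFriedlanderIwaniecTheorem5StarInterval) {a : ℤ} (ha : a ≠ 0)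
    {ε : ℝ} (hε : 0 < ε) (hε' : ε ≤ 1 / 1000) {A₅ : ℝ} (hA₅ : 0 ≤ A₅) :
    ∃ C x₀ : ℝ, 0 ≤ C ∧ ∀ x : ℝ, x₀ ≤ x → ∀ (X' M N P P' z : ℝ) (α β lam : ℕ → ℝ),
      IsWellFactorable (x ^ (4 / 7 - ε)) lam →
      x ≤ X' → X' ≤ 2 ^ 15 * x → M * N = X' →
      X' ^ (3 / 7 - ε) < M → M ≤ X' ^ (1 - ε / 100) →
      z ≤ Real.exp (Real.sqrt (Real.log x)) →
      (∀ m ∈ dyadic M, α m = if P < m ∧ (m : ℝ) ≤ P' then (if IsRough z m then 1 else 0) else 0) →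
      (∀ n, |β n| ≤ (σ 0 n : ℝ) ^ 13) →
      |∑ d ∈ (Icc 1 ⌊x ^ (4 / 7 - ε)⌋₊).filter (fun d : ℕ => IsCoprime (d : ℤ) a),
          lam d * bilinDisc a M N α β d| ≤ C * x / Real.log x ^ A₅ := by
  obtain ⟨Cl, hCl, hl2⟩ := exists_l2Sq_le_of_abs_le_sigma_zero_pow 13
  obtain ⟨E', hE'⟩ : ∃ E' : ℕ, 2 ^ (2 * 13 + 1) = 2 * E' := ⟨2 ^ 26, by norm_num⟩
  rw [hE'] at hl2
  set A' : ℝ := A₅ + E' + 2 with hA'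
  have hA'0 : 0 < A' := by rw [hA']; positivity
  obtain ⟨C₅, x₅, h5'⟩ := h5 a ha (ε / 100) (by positivity) A' hA'0 0 le_rfl
  obtain ⟨x₀, hx₀⟩ := eventually_caseB x₅
  refine ⟨16 * 2 ^ 15 * 2 ^ E' * max C₅ 0 * Real.sqrt Cl, x₀, by positivity,
    fun x hx X' M N P P' z α β lam hlam hxX hX'x hMN hM1 hM2 hz hα hβ => ?_⟩
  obtain ⟨hx₅, hxe, hx15⟩ := hx₀ x hx
  have hee : (2 : ℝ) < Real.exp (Real.exp 1) := by
    have h1 : (1 : ℝ) < Real.exp 1 := by have := Real.exp_one_gt_d9; linarith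
    have h2 : Real.exp 1 < Real.exp (Real.exp 1) := Real.exp_lt_exp.2 h1
    have := Real.exp_one_gt_d9; linarith
  have hx2 : (2 : ℝ) ≤ x := by linarith
  have hx0 : 0 < x := by linarith
  have hx1 : (1 : ℝ) ≤ x := by linarith
  have hX'2 : (2 : ℝ) ≤ X' := hx2.trans hxX
  have hX'0 : 0 < X' := by linarith
  have hX'1 : (1 : ℝ) < X' := by linarith
  have hLx : 1 ≤ Real.log x := by
    rw [Real.le_log_iff_exp_le hx0]
    refine le_trans ?_ hxe
    exact Real.exp_le_exp.2 (by have := Real.exp_one_gt_d9; linarith)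
  have hLX : Real.log x ≤ Real.log X' := Real.log_le_log hx0 hxX
  have hLX1 : 1 ≤ Real.log X' := hLx.trans hLX
  -- the exponent `τ` of `M`
  have hM0 : 0 < M := lt_trans (Real.rpow_pos_of_pos hX'0 _) hM1
  set τ : ℝ := Real.log M / Real.log X' with hτ
  have hMτ : M = X' ^ τ := by
    rw [Real.rpow_def_of_pos hX'0, hτ, mul_div_cancel₀ _ (by linarith), Real.exp_log hM0]
  have hτ1 : 3 / 7 - ε < τ := by
    rw [hMτ] at hM1; exact (Real.rpow_lt_rpow_left_iff hX'1).1 hM1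
  have hτ2 : τ ≤ 1 - ε / 100 := by
    rw [hMτ] at hM2; exact (Real.rpow_le_rpow_left_iff hX'1).1 hM2
  have hN : N = X' ^ (1 - τ) := by
    have h : N = X' / M := by field_simp; linarith
    rw [h, hMτ, Real.rpow_sub hX'0, Real.rpow_one]
  have hN1 : 1 ≤ N := by
    rw [hN]; exact Real.one_le_rpow hX'1.le (by linarith)
  have hNX : N ≤ X' := by
    rw [hN]
    calc X' ^ (1 - τ) ≤ X' ^ (1 : ℝ) := Real.rpow_le_rpow_of_exponent_le hX'1.le (by linarith)
      _ = X' := Real.rpow_one X'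
  -- the levels
  set D : ℝ := x ^ (4 / 7 - ε) with hD
  set D₂ : ℝ := X' ^ (1 / 7 + ε / 50) with hD₂
  have hD₂1 : 1 ≤ D₂ := Real.one_le_rpow hX'1.le (by linarith)
  have hD₂D : D₂ ≤ D := by
    -- `X'^{1/7+ε/50} ≤ (x²)^{1/7+ε/50} ≤ x^{4/7−ε}` using `X' ≤ 2^15 x ≤ x²`
    have hX'xx : X' ≤ x ^ (2 : ℝ) := by rw [Real.rpow_two]; nlinarith
    calc D₂ ≤ (x ^ (2 : ℝ)) ^ (1 / 7 + ε / 50) := Real.rpow_le_rpow hX'0.le hX'xx (by linarith)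
      _ = x ^ (2 * (1 / 7 + ε / 50)) := by rw [← Real.rpow_mul hx0.le]
      _ ≤ D := Real.rpow_le_rpow_of_exponent_le hx1 (by linarith)
  have hD₁le : D / D₂ ≤ X' ^ (3 / 7 - ε - ε / 50) := by
    have h1 : D ≤ X' ^ (4 / 7 - ε) := Real.rpow_le_rpow hx0.le hxX (by linarith)
    rw [div_le_iff₀ (by linarith)]
    have h2 : X' ^ (3 / 7 - ε - ε / 50) * D₂ = X' ^ (4 / 7 - ε) := by
      rw [hD₂, ← Real.rpow_add hX'0]; congr 1; ring
    rw [h2]; exact h1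
  obtain ⟨lam₁, lam₂, K₁, hl1, hl2', hs1, hs2, hK₁, hblocks, hdec⟩ := wellFactorable_blocks hlam hD₂1 hD₂D
  obtain ⟨K₂, hK₂, hK₂'⟩ := exists_pow_two_near hD₂1
  have hdec' := hdec a M N α β K₂
  -- the remainder segment is empty
  have hfl : ⌊D₂ / 2 ^ K₂⌋₊ = 0 := Nat.floor_eq_zero.2 (by rw [div_lt_one (by positivity)]; exact hK₂)
  rw [hfl] at hdec'
  simp only [show (Icc 1 0 : Finset ℕ) = ∅ from rfl, Finset.sum_empty, Finset.sum_const_zero,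
    zero_add] at hdec'
  rw [hdec']
  -- the block bound from Theorem 5*
  have hγ : ∀ q, |lam₁ q| ≤ (σ 0 q : ℝ) ^ (0 : ℝ) := fun q => by rw [Real.rpow_zero]; exact hl1 q
  have hδ : ∀ r, |lam₂ r| ≤ (σ 0 r : ℝ) ^ (0 : ℝ) := fun r => by rw [Real.rpow_zero]; exact hl2' r
  have hzX : z ≤ Real.exp (Real.log X' / Real.log (Real.log X')) := hz.trans (exp_sqrt_log_le hxe hxX)
  have hαeq : ∀ m ∈ dyadic M, α m = (if P < m ∧ (m : ℝ) ≤ P' then roughIndicator z m else 0) := by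
    intro m hm; rw [hα m hm, roughIndicator_eq_ite]
  set B : ℝ := max C₅ 0 * (Real.sqrt Cl * (2 * Real.log X') ^ E' * X') / Real.log X' ^ A' with hB
  have hblock : ∀ k, k < K₁ → ∀ k', k' < K₂ →
      |dispD a M N (D / D₂ / 2 ^ (k + 1)) (D₂ / 2 ^ (k' + 1)) α β lam₁ lam₂| ≤ B := by
    intro k hk k' hk'
    obtain ⟨hQ0, hQle⟩ := hblocks k hk
    set Q : ℝ := D / D₂ / 2 ^ (k + 1) with hQ
    set R : ℝ := D₂ / 2 ^ (k' + 1) with hR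
    have hR0 : 1 / 2 ≤ R := by
      rw [hR, le_div_iff₀ (by positivity)]
      have hpow : (2 : ℝ) ^ (k' + 1) ≤ 2 ^ K₂ := pow_le_pow_right₀ (by norm_num) hk'
      linarith
    have hRle : R ≤ X' ^ (1 / 7 + ε / 50) := by
      rw [hR]
      calc D₂ / 2 ^ (k' + 1) ≤ D₂ / 1 := div_le_div_of_nonneg_left (by linarith) one_pos
            (one_le_pow₀ (by norm_num))
        _ = X' ^ (1 / 7 + ε / 50) := by rw [div_one]
    have hQle' : Q ≤ X' ^ (3 / 7 - ε - ε / 50) :=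
      hQle.trans ((div_le_self (by linarith) (by norm_num)).trans hD₁le)
    obtain ⟨hN1', hN2', hQR, hthr⟩ :=
      thm5_ranges' hε hε' hτ1 hτ2 hX'2 hMτ hMN hQ0 hR0 hQle' hRle
    have h := h5' X' (hx₅.trans hxX) M N Q R hMN hN1' hN2' hQ0 hR0 hQR hthr z hzX P P' β lam₁ lam₂ hγ hδ
    rw [← dispD_congr_alpha N Q R hαeq β lam₁ lam₂] at h
    refine h.trans ?_
    rw [hB]
    have hden : 0 < Real.log X' ^ A' := Real.rpow_pos_of_pos (by linarith) _
    rw [div_le_div_iff_of_pos_right hden]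
    calc C₅ * Real.sqrt (l2Sq N β) * X' ^ (1 / 2 : ℝ) * M ^ (1 / 2 : ℝ)
        ≤ max C₅ 0 * (Real.sqrt (l2Sq N β) * X' ^ (1 / 2 : ℝ) * M ^ (1 / 2 : ℝ)) := by
          have h0 : 0 ≤ Real.sqrt (l2Sq N β) * X' ^ (1 / 2 : ℝ) * M ^ (1 / 2 : ℝ) := by positivity
          calc C₅ * Real.sqrt (l2Sq N β) * X' ^ (1 / 2 : ℝ) * M ^ (1 / 2 : ℝ)
              = C₅ * (Real.sqrt (l2Sq N β) * X' ^ (1 / 2 : ℝ) * M ^ (1 / 2 : ℝ)) := by ring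
            _ ≤ _ := mul_le_mul_of_nonneg_right (le_max_left _ _) h0
      _ ≤ max C₅ 0 * (Real.sqrt Cl * (2 * Real.log X') ^ E' * X') :=
          mul_le_mul_of_nonneg_left (sqrt_l2Sq_mul_le hN1 hM0.le hX'2 hMN hCl (hl2 N hN1 β hβ) hNX)
            (le_max_right _ _)
  refine (abs_sum_sum_range_le hblock).trans ?_
  -- counting the blocks and converting `log X'` into `log x`
  have hD₁1 : 1 ≤ D / D₂ := by rwa [le_div_iff₀ (by linarith), one_mul]
  have hD₁X : D / D₂ ≤ X' := hD₁le.trans (by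
    calc X' ^ (3 / 7 - ε - ε / 50) ≤ X' ^ (1 : ℝ) := Real.rpow_le_rpow_of_exponent_le hX'1.le (by linarith)
      _ = X' := Real.rpow_one X')
  have hD₂X : D₂ ≤ X' := by
    calc D₂ ≤ X' ^ (1 : ℝ) := Real.rpow_le_rpow_of_exponent_le hX'1.le (by linarith)
      _ = X' := Real.rpow_one X'
  have hK₁le : (K₁ : ℝ) ≤ 4 * Real.log X' := natCast_le_four_mul_log hK₁ hD₁1 hX'2 hD₁X
  have hK₂le : (K₂ : ℝ) ≤ 4 * Real.log X' := natCast_le_four_mul_log hK₂' hD₂1 hX'2 hD₂X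
  have hB0 : 0 ≤ B := by rw [hB]; positivity
  have hLX0 : 0 < Real.log X' := by linarith
  -- `(log X')^{E'+2} / (log X')^{A'} = (log X')^{-A₅} ≤ (log x)^{-A₅}`
  have hpow : Real.log X' ^ (E' + 2) / Real.log X' ^ A' ≤ (Real.log x ^ A₅)⁻¹ := by
    rw [← Real.rpow_natCast, ← Real.rpow_sub hLX0, ← Real.rpow_neg (by linarith)]
    have he : ((E' + 2 : ℕ) : ℝ) - A' = -A₅ := by rw [hA']; push_cast; ring
    rw [he]
    exact Real.rpow_le_rpow_of_nonpos (by linarith) hLX (by linarith)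
  calc (K₁ : ℝ) * K₂ * B ≤ (4 * Real.log X') * (4 * Real.log X') * B := by
        have hK₁0 : (0 : ℝ) ≤ K₁ := Nat.cast_nonneg _
        have hK₂0 : (0 : ℝ) ≤ K₂ := Nat.cast_nonneg _
        exact mul_le_mul_of_nonneg_right (mul_le_mul hK₁le hK₂le hK₂0 (by positivity)) hB0
    _ = 16 * 2 ^ E' * max C₅ 0 * Real.sqrt Cl * X' * (Real.log X' ^ (E' + 2) / Real.log X' ^ A') := by
        rw [hB, mul_pow]; ring
    _ ≤ 16 * 2 ^ E' * max C₅ 0 * Real.sqrt Cl * (2 ^ 15 * x) * (Real.log x ^ A₅)⁻¹ := by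
        refine mul_le_mul (mul_le_mul_of_nonneg_left hX'x (by positivity)) hpow (by positivity)
          (by positivity)
    _ = 16 * 2 ^ 15 * 2 ^ E' * max C₅ 0 * Real.sqrt Cl * x / Real.log x ^ A₅ := by ring

/-! ### Case B2: the fundamental lemma -/

/-- The large-`x` facts used by Case B2 (one existential witness). [folklore] -/
theorem eventually_caseB2 (x₁ x₂ : ℝ) :
    ∃ x₀ : ℝ, ∀ x : ℝ, x₀ ≤ x → x₁ ≤ x ∧ x₂ ≤ x ∧ Real.exp 49 ≤ x ∧ (2 : ℝ) ^ 15 ≤ x := by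
  refine ⟨max x₁ (max x₂ (max (Real.exp 49) (2 ^ 15))), fun x hx => ⟨?_, ?_, ?_, ?_⟩⟩
  · exact le_trans (le_max_left _ _) hx
  · exact le_trans ((le_max_left _ _).trans (le_max_right _ _)) hx
  · exact le_trans ((le_max_left _ _).trans ((le_max_right _ _).trans (le_max_right _ _))) hx
  · exact le_trans ((le_max_right _ _).trans ((le_max_right _ _).trans (le_max_right _ _))) hx

/-- **Case B2 of §17: the large smooth variable exceeds `X'^{1−ε/100}`.**  Then Theorem 5* does not
apply (hypothesis (A₁) fails) and the piece is handled by the fundamental lemma modulus by modulus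
(`Literature.NumberTheory.Sieve.BFI.sum_abs_bilinDisc_roughBox_le`, sieve level `x^{1/7}`,
`z = exp(√log x)`): for `α = 1_{(P,P']} · 1_{(·,P(z))=1}` on `m ∼ M`, `X'^{1−ε/100} < M ≤ X'`,
`x ≤ X' ≤ 2^{15} x`, `|λ| ≤ 1`, and `β` either divisor-bounded on `n ∼ N` with `MN = X'`, `N ≥ 1`,
or the unit `δ₁` (`N = 1/2`, `M = X'`):
`|∑_{d ≤ x^{4/7−ε}, (d,a)=1} λ(d) Δ_{α⋆β}(d)| ≤ C x (log x)^{−A₅}` for `x ≥ x₀`.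
(BFI §12 p. 238: the almost-prime variable is treated by the fundamental lemma, Lemma 4 p. 211.)
[cite: BombieriFriedlanderIwaniecActa1986, §12 p. 238; §2 Lemma 4 p. 211] -/
theorem caseB2_bound (hFL : SieveSequence.fundamental_lemma_uniform) (a : ℤ)
    {ε : ℝ} (hε : 0 < ε) (hε' : ε ≤ 1 / 1000) {A₅ : ℝ} (hA₅ : 0 ≤ A₅) :
    ∃ C x₀ : ℝ, 0 ≤ C ∧ ∀ x : ℝ, x₀ ≤ x → ∀ (X' M N P P' : ℝ) (F G lam : ℕ → ℝ),
      (∀ n, |lam n| ≤ 1) → x ≤ X' → X' ≤ 2 ^ 15 * x → X' ^ (1 - ε / 100) < M → M ≤ X' →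
      M ≤ P → P ≤ P' → P' ≤ 2 * M →
      (∀ m ∈ dyadic M, F m = if P < m ∧ (m : ℝ) ≤ P' then
        (if IsRough (Real.exp (Real.sqrt (Real.log x))) m then 1 else 0) else 0) →
      ((1 ≤ N ∧ M * N = X' ∧ ∀ n, |G n| ≤ (σ 0 n : ℝ) ^ 13) ∨
        (N = 1 / 2 ∧ M = X' ∧ ∀ n ∈ dyadic N, |G n| ≤ 1)) →
      |∑ d ∈ (Icc 1 ⌊x ^ (4 / 7 - ε)⌋₊).filter (fun d : ℕ => IsCoprime (d : ℤ) a),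
          lam d * bilinDisc a M N F G d| ≤ C * x / Real.log x ^ A₅ := by
  obtain ⟨Cr, hCr, hr⟩ := sum_abs_bilinDisc_roughBox_le hFL a
  obtain ⟨Ca, hCa, hCa'⟩ := exists_sum_abs_le_of_abs_le_sigma_zero_pow 13
  obtain ⟨E14, hE14⟩ : ∃ E14 : ℕ, E14 = 2 ^ (13 + 1) := ⟨_, rfl⟩
  rw [← hE14] at hCa'
  obtain ⟨Ce, hCe, he⟩ := exists_rpow_mul_exp_neg_sqrt_le ((E14 : ℝ) + 8 + A₅) (show (0:ℝ) < 1 / 7 by norm_num)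
  obtain ⟨Cp, hCp, hp⟩ := exists_log_rpow_le_rpow (show (0:ℝ) ≤ (E14 : ℝ) + 8 + A₅ by positivity)
    (show (0:ℝ) < 1 / 4 by norm_num)
  -- the `x`-threshold: `3 Cr (Ca + 2) 4^{E14} Cp ≤ x^{1/100}` absorbs the power-saving term
  obtain ⟨x₂, hx₂⟩ := exists_polylog_le_rpow (show (0:ℝ) ≤ 3 * Cr * (Ca + 2) * 4 ^ E14 * Cp by positivity)
    (le_refl (0:ℝ)) (show (0:ℝ) < 1 / 100 by norm_num)
  obtain ⟨x₀, hx₀⟩ := eventually_caseB2 x₂ x₂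
  refine ⟨2 ^ 15 * Cr * (Ca + 2) * 4 ^ E14 * Ce + 1, x₀, by positivity,
    fun x hx X' M N P P' F G lam hlam hxX hX'x hM1 hMX hMP hPP' hP'M hF hG => ?_⟩
  obtain ⟨hx₂', -, hxe, hx15⟩ := hx₀ x hx
  have hx2 : (2 : ℝ) ≤ x := by linarith
  have hx0 : 0 < x := by linarith
  have hx1 : (1 : ℝ) ≤ x := by linarith
  have hX'1 : (1 : ℝ) ≤ X' := hx1.trans hxX
  have hX'2 : (2 : ℝ) ≤ X' := hx2.trans hxX
  have hX'0 : 0 < X' := by linarith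
  have hX'xx : X' ≤ x ^ 2 := by
    calc X' ≤ 2 ^ 15 * x := hX'x
      _ ≤ x * x := mul_le_mul_of_nonneg_right hx15 hx0.le
      _ = x ^ 2 := (sq x).symm
  set L : ℝ := Real.log x with hL
  have hL49 : 49 ≤ L := by rw [hL, Real.le_log_iff_exp_le hx0]; exact hxe
  have hL1 : 1 ≤ L := by linarith
  have hL0 : 0 < L := by linarith
  set z : ℝ := Real.exp (Real.sqrt L) with hz
  have hsqrt7 : 7 ≤ Real.sqrt L := by
    rw [show (7:ℝ) = Real.sqrt 49 by rw [show (49:ℝ) = 7 ^ 2 by norm_num, Real.sqrt_sq (by norm_num)]]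
    exact Real.sqrt_le_sqrt hL49
  have hz2 : 2 ≤ z := by
    rw [hz]
    have h1 : Real.exp 1 ≤ Real.exp (Real.sqrt L) := Real.exp_le_exp.2 (by linarith)
    have := Real.exp_one_gt_d9; linarith
  have hsq : Real.sqrt L * Real.sqrt L = L := Real.mul_self_sqrt hL0.le
  have hzx : z ≤ x ^ (1 / 7 : ℝ) := by
    rw [hz, Real.rpow_def_of_pos hx0, Real.exp_le_exp, ← hL]
    -- `√L ≤ L/7` since `√L ≥ 7`
    calc Real.sqrt L = (1 / 7) * (7 * Real.sqrt L) := by ring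
      _ ≤ (1 / 7) * (Real.sqrt L * Real.sqrt L) :=
          mul_le_mul_of_nonneg_left (mul_le_mul_of_nonneg_right hsqrt7 (Real.sqrt_nonneg _)) (by norm_num)
      _ = L * (1 / 7) := by rw [hsq]; ring
  have hlogz : Real.log (x ^ (1 / 7 : ℝ)) / Real.log z = Real.sqrt L / 7 := by
    rw [Real.log_rpow hx0, hz, Real.log_exp, ← hL]
    have h2 : Real.sqrt L ≠ 0 := by positivity
    rw [div_eq_iff h2]
    linear_combination (-(1:ℝ) / 7) * hsq
  have hM1' : 1 ≤ M := by
    have : (1 : ℝ) ≤ X' ^ (1 - ε / 100) := Real.one_le_rpow hX'1 (by linarith)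
    linarith
  have hM0 : 0 < M := by linarith
  -- `N ≥ 0` and `‖G‖₁ ≤ (Ca + 2) N' (4L)^{E14}` with `M N' ≤ X'` and `N' ≤ X'^{ε/100}`-ish
  set Dn : ℕ := ⌊x ^ (4 / 7 - ε)⌋₊ with hDn
  have hDnx : (Dn : ℝ) ≤ x := by
    refine (Nat.floor_le (Real.rpow_nonneg hx0.le _)).trans ?_
    calc x ^ (4 / 7 - ε) ≤ x ^ (1 : ℝ) := Real.rpow_le_rpow_of_exponent_le hx1 (by linarith)
      _ = x := Real.rpow_one x
  have hDn47 : (Dn : ℝ) ≤ x ^ (4 / 7 : ℝ) :=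
    (Nat.floor_le (Real.rpow_nonneg hx0.le _)).trans (Real.rpow_le_rpow_of_exponent_le hx1 (by linarith))
  have hN0 : 0 ≤ N := by rcases hG with ⟨h1, -, -⟩ | ⟨h1, -, -⟩ <;> linarith
  have hLX : Real.log X' ≤ 2 * L := by
    calc Real.log X' ≤ Real.log (x ^ 2) := Real.log_le_log hX'0 hX'xx
      _ = 2 * L := by rw [Real.log_pow, hL]; norm_num
  -- `‖G‖₁ M ≤ (Ca + 2) X' (4L)^{E14}` and `‖G‖₁ ≤ (Ca + 2) X'^{ε/100} (4L)^{E14}`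
  have hG1 : (∑ n ∈ dyadic N, |G n|) * M ≤ (Ca + 2) * X' * (4 * L) ^ E14 ∧
      (∑ n ∈ dyadic N, |G n|) ≤ (Ca + 2) * X' ^ (ε / 100) * (4 * L) ^ E14 := by
    have h4L1 : 1 ≤ (4 * L) ^ E14 := one_le_pow₀ (by linarith)
    rcases hG with ⟨hN1, hMN, hGτ⟩ | ⟨hN, hMX', hG1⟩
    · have hNX : N ≤ X' := by
        calc N = 1 * N := (one_mul N).symm
          _ ≤ M * N := mul_le_mul_of_nonneg_right hM1' (by linarith)
          _ = X' := hMN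
      have hlog2N : Real.log (2 * N) ≤ 4 * L := by
        have h1 : 2 * N ≤ X' ^ 2 := by
          calc 2 * N ≤ 2 * X' := by linarith
            _ ≤ X' * X' := mul_le_mul_of_nonneg_right hX'2 hX'0.le
            _ = X' ^ 2 := (sq X').symm
        calc Real.log (2 * N) ≤ Real.log (X' ^ 2) := Real.log_le_log (by linarith) h1
          _ = 2 * Real.log X' := by rw [Real.log_pow]; norm_num
          _ ≤ 4 * L := by linarith
      have hS : ∑ n ∈ dyadic N, |G n| ≤ Ca * N * (4 * L) ^ E14 :=
        (hCa' N hN1 G hGτ).trans (mul_le_mul_of_nonneg_left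
          (pow_le_pow_left₀ (Real.log_nonneg (by linarith)) hlog2N E14) (by positivity))
      have hNε : N ≤ X' ^ (ε / 100) := by
        -- `N = X'/M < X'/X'^{1-ε/100} = X'^{ε/100}`
        have h1 : N * X' ^ (1 - ε / 100) ≤ N * M := mul_le_mul_of_nonneg_left hM1.le (by linarith)
        rw [mul_comm N M, hMN] at h1
        have h2 : X' = X' ^ (ε / 100) * X' ^ (1 - ε / 100) := by
          rw [← Real.rpow_add hX'0]; norm_num
        have h3 : 0 < X' ^ (1 - ε / 100) := Real.rpow_pos_of_pos hX'0 _
        exact le_of_mul_le_mul_right (h1.trans h2.le) h3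
      refine ⟨?_, ?_⟩
      · calc (∑ n ∈ dyadic N, |G n|) * M ≤ Ca * N * (4 * L) ^ E14 * M := mul_le_mul_of_nonneg_right hS hM0.le
          _ = Ca * (M * N) * (4 * L) ^ E14 := by ring
          _ ≤ (Ca + 2) * X' * (4 * L) ^ E14 := by
              rw [hMN]; gcongr; linarith
      · calc ∑ n ∈ dyadic N, |G n| ≤ Ca * N * (4 * L) ^ E14 := hS
          _ ≤ (Ca + 2) * X' ^ (ε / 100) * (4 * L) ^ E14 := by gcongr; linarith
    · have hS : ∑ n ∈ dyadic N, |G n| ≤ 2 := by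
        calc ∑ n ∈ dyadic N, |G n| ≤ ∑ n ∈ dyadic N, (1 : ℝ) := Finset.sum_le_sum hG1
          _ = #(dyadic N) := by simp
          _ ≤ 2 * N + 1 := card_dyadic_le hN0
          _ = 2 := by rw [hN]; norm_num
      have hXε1 : 1 ≤ X' ^ (ε / 100) := Real.one_le_rpow hX'1 (by positivity)
      refine ⟨?_, ?_⟩
      · calc (∑ n ∈ dyadic N, |G n|) * M ≤ 2 * M := mul_le_mul_of_nonneg_right hS hM0.le
          _ = 2 * X' * 1 := by rw [hMX', mul_one]
          _ ≤ (Ca + 2) * X' * (4 * L) ^ E14 := by gcongr; linarith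
      · calc ∑ n ∈ dyadic N, |G n| ≤ 2 := hS
          _ = 2 * 1 * 1 := by ring
          _ ≤ (Ca + 2) * X' ^ (ε / 100) * (4 * L) ^ E14 := by gcongr; linarith
  -- the fundamental-lemma bound
  have hmain := hr x z M N P P' F G Dn hx2 hz2 hzx hM1' hMP hPP' hP'M hN0 hDnx hF
  rw [hlogz] at hmain
  have hfilter : |∑ d ∈ (Icc 1 Dn).filter (fun d : ℕ => IsCoprime (d : ℤ) a), lam d * bilinDisc a M N F G d| ≤
      ∑ d ∈ (Icc 1 Dn).filter (fun d : ℕ => IsCoprime (d : ℤ) a), |bilinDisc a M N F G d| := by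
    refine (Finset.abs_sum_le_sum_abs _ _).trans (Finset.sum_le_sum fun d _ => ?_)
    rw [abs_mul]
    exact (mul_le_mul_of_nonneg_right (hlam d) (abs_nonneg _)).trans (by rw [one_mul])
  refine hfilter.trans (hmain.trans ?_)
  -- Term 1: `Cr ‖G‖₁ M e^{-√L/7} L^8 ≤ 2^15 Cr (Ca+2) 4^{E14} Ce x / L^{A₅}`
  have hT1 : Cr * (∑ n ∈ dyadic N, |G n|) * (M * Real.exp (-(Real.sqrt L / 7))) * L ^ 8 ≤
      2 ^ 15 * Cr * (Ca + 2) * 4 ^ E14 * Ce * x / L ^ A₅ := by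
    have h1 := he L hL1
    -- `L^{E14+8+A₅} e^{-√L/7} ≤ Ce` ⇒ `L^{E14} L^8 e^{-√L/7} ≤ Ce L^{-A₅}`
    have h2 : (4 * L) ^ E14 * L ^ 8 * Real.exp (-(Real.sqrt L / 7)) ≤ 4 ^ E14 * Ce * (L ^ A₅)⁻¹ := by
      have hLA : 0 < L ^ A₅ := Real.rpow_pos_of_pos hL0 _
      rw [← div_eq_mul_inv, le_div_iff₀ hLA]
      have h3 : L ^ ((E14 : ℝ) + 8 + A₅) = L ^ E14 * L ^ 8 * L ^ A₅ := by
        rw [Real.rpow_add hL0, Real.rpow_add hL0, Real.rpow_natCast]; norm_num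
      rw [show -(1 / 7 * Real.sqrt L) = -(Real.sqrt L / 7) by ring, h3] at h1
      calc (4 * L) ^ E14 * L ^ 8 * Real.exp (-(Real.sqrt L / 7)) * L ^ A₅
          = 4 ^ E14 * (L ^ E14 * L ^ 8 * L ^ A₅ * Real.exp (-(Real.sqrt L / 7))) := by rw [mul_pow]; ring
        _ ≤ 4 ^ E14 * Ce := mul_le_mul_of_nonneg_left h1 (by positivity)
    calc Cr * (∑ n ∈ dyadic N, |G n|) * (M * Real.exp (-(Real.sqrt L / 7))) * L ^ 8
        = Cr * ((∑ n ∈ dyadic N, |G n|) * M) * (L ^ 8 * Real.exp (-(Real.sqrt L / 7))) := by ring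
      _ ≤ Cr * ((Ca + 2) * X' * (4 * L) ^ E14) * (L ^ 8 * Real.exp (-(Real.sqrt L / 7))) :=
          mul_le_mul_of_nonneg_right (mul_le_mul_of_nonneg_left hG1.1 hCr) (by positivity)
      _ = Cr * (Ca + 2) * X' * ((4 * L) ^ E14 * L ^ 8 * Real.exp (-(Real.sqrt L / 7))) := by ring
      _ ≤ Cr * (Ca + 2) * (2 ^ 15 * x) * (4 ^ E14 * Ce * (L ^ A₅)⁻¹) :=
          mul_le_mul (mul_le_mul_of_nonneg_left hX'x (by positivity)) h2 (by positivity) (by positivity)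
      _ = 2 ^ 15 * Cr * (Ca + 2) * 4 ^ E14 * Ce * x / L ^ A₅ := by ring
  -- Term 2: `Cr ‖G‖₁ x^{1/7} (Dn + 2) L^8 ≤ x / L^{A₅}`
  have hT2 : Cr * (∑ n ∈ dyadic N, |G n|) * (x ^ (1 / 7 : ℝ) * (Dn + 2)) * L ^ 8 ≤ 1 * x / L ^ A₅ := by
    have hXε : X' ^ (ε / 100) ≤ x ^ (1 / 100 : ℝ) := by
      calc X' ^ (ε / 100) ≤ (x ^ (2 : ℝ)) ^ (ε / 100) := by
            refine Real.rpow_le_rpow hX'0.le ?_ (by positivity)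
            rw [Real.rpow_two]; exact hX'xx
        _ = x ^ (2 * (ε / 100)) := by rw [← Real.rpow_mul hx0.le]
        _ ≤ x ^ (1 / 100 : ℝ) := Real.rpow_le_rpow_of_exponent_le hx1 (by linarith)
    have hD2 : x ^ (1 / 7 : ℝ) * (Dn + 2) ≤ 3 * x ^ (5 / 7 : ℝ) := by
      have h1 : (Dn : ℝ) + 2 ≤ 3 * x ^ (4 / 7 : ℝ) := by
        have : (1 : ℝ) ≤ x ^ (4 / 7 : ℝ) := Real.one_le_rpow hx1 (by norm_num)
        linarith
      calc x ^ (1 / 7 : ℝ) * (Dn + 2) ≤ x ^ (1 / 7 : ℝ) * (3 * x ^ (4 / 7 : ℝ)) :=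
            mul_le_mul_of_nonneg_left h1 (Real.rpow_nonneg hx0.le _)
        _ = 3 * (x ^ (1 / 7 : ℝ) * x ^ (4 / 7 : ℝ)) := by ring
        _ = 3 * x ^ (5 / 7 : ℝ) := by rw [← Real.rpow_add hx0]; norm_num
    -- polylog: `L^{E14+8+A₅} ≤ Cp x^{1/4}`, and `3 Cr (Ca+2) 4^{E14} Cp ≤ x^{1/100}` is `hx₂`
    have hP := hp x hx1
    have hQ := hx₂ x hx₂'
    rw [Real.rpow_zero, mul_one] at hQ
    have hLA : 0 < L ^ A₅ := Real.rpow_pos_of_pos hL0 _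
    rw [le_div_iff₀ hLA, one_mul]
    have h3 : L ^ ((E14 : ℝ) + 8 + A₅) = L ^ E14 * L ^ 8 * L ^ A₅ := by
      rw [Real.rpow_add hL0, Real.rpow_add hL0, Real.rpow_natCast]; norm_num
    rw [← hL, h3] at hP
    have h4L : (4 * L) ^ E14 = 4 ^ E14 * L ^ E14 := mul_pow _ _ _
    calc Cr * (∑ n ∈ dyadic N, |G n|) * (x ^ (1 / 7 : ℝ) * (Dn + 2)) * L ^ 8 * L ^ A₅
        ≤ Cr * ((Ca + 2) * x ^ (1 / 100 : ℝ) * (4 ^ E14 * L ^ E14)) * (3 * x ^ (5 / 7 : ℝ)) * L ^ 8 * L ^ A₅ := by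
          have i1 : (∑ n ∈ dyadic N, |G n|) ≤ (Ca + 2) * x ^ (1 / 100 : ℝ) * (4 ^ E14 * L ^ E14) := by
            rw [← h4L]
            exact hG1.2.trans (mul_le_mul_of_nonneg_right (mul_le_mul_of_nonneg_left hXε (by positivity))
              (by positivity))
          gcongr
      _ = 3 * Cr * (Ca + 2) * 4 ^ E14 * (x ^ (1 / 100 : ℝ) * x ^ (5 / 7 : ℝ)) * (L ^ E14 * L ^ 8 * L ^ A₅) := by ring
      _ ≤ 3 * Cr * (Ca + 2) * 4 ^ E14 * (x ^ (1 / 100 : ℝ) * x ^ (5 / 7 : ℝ)) * (Cp * x ^ (1 / 4 : ℝ)) :=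
          mul_le_mul_of_nonneg_left hP (by positivity)
      _ = (3 * Cr * (Ca + 2) * 4 ^ E14 * Cp) * (x ^ (1 / 100 : ℝ) * x ^ (5 / 7 : ℝ) * x ^ (1 / 4 : ℝ)) := by ring
      _ ≤ x ^ (1 / 100 : ℝ) * (x ^ (1 / 100 : ℝ) * x ^ (5 / 7 : ℝ) * x ^ (1 / 4 : ℝ)) :=
          mul_le_mul_of_nonneg_right hQ (by positivity)
      _ = x ^ ((1 / 100 : ℝ) + (1 / 100 + 5 / 7 + 1 / 4)) := by
          rw [← Real.rpow_add hx0, ← Real.rpow_add hx0, ← Real.rpow_add hx0]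
      _ ≤ x ^ (1 : ℝ) := Real.rpow_le_rpow_of_exponent_le hx1 (by norm_num)
      _ = x := Real.rpow_one x
  calc Cr * (∑ n ∈ dyadic N, |G n|) *
        (M * Real.exp (-(Real.sqrt L / 7)) + x ^ (1 / 7 : ℝ) * (Dn + 2)) * Real.log x ^ 8
      = Cr * (∑ n ∈ dyadic N, |G n|) * (M * Real.exp (-(Real.sqrt L / 7))) * L ^ 8 +
          Cr * (∑ n ∈ dyadic N, |G n|) * (x ^ (1 / 7 : ℝ) * (Dn + 2)) * L ^ 8 := by rw [← hL]; ring
    _ ≤ 2 ^ 15 * Cr * (Ca + 2) * 4 ^ E14 * Ce * x / L ^ A₅ + 1 * x / L ^ A₅ := add_le_add hT1 hT2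
    _ = (2 ^ 15 * Cr * (Ca + 2) * 4 ^ E14 * Ce + 1) * x / Real.log x ^ A₅ := by rw [← hL]; ring

end BFI

end Literature.NumberTheory.Sieve
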